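import Summits.QuantumFields.YangMills.Theorems.AlphaInputsT3ACv3LinearLiftSmoothGauge
import HarnessLib

/-!
# `AlphaInputsT3ACv3LinearLiftCutoff` — (LL+) SMOOTH CUTOFFS AT SCALE `L^k` FROM THE SPREAD OF AN INDICATOR: `χ_Y := S0 k 1_Y` is `≡ 1` one cell inside `Y`, `≡ 0` one cell outside `Y`,
# `|χ_Y| ≤ 18^d` and `|dχ_Y| ≤ 18^d/L^k` — the partition-of-unity letter of every blending step (chart transitions, boundary layers) — cell `ym3-torus`, width seat `ym-ust-19936-w2` (g2)

WHY (w1-19936 `NONABELIAN-FL-ARCH` §6 «partition of unity χ_π built from w2's S⁰ profiles (scale L^{k−s}, |dχ| ≤ 12/L^{k−s})»; w4-19936 `NEWTON-FL-FRAMES` §4; this seat's PROGRESS 1–2).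
Blending two finest candidates that differ by a smooth `O(η)` one-form `D` across a strip of width `L^k` costs `|dχ|·|D| + |χ|·|curl D|` in curl; with `χ = S0 k 1_Y` both factors are
`k`-UNIFORM (`18^d/L^k`, `18^d`), and `χ` is EXACTLY `1`∕`0` away from the one-cell collar of `∂Y` (locality `Near` + partition of unity), so nothing is perturbed off the strip.
WHAT (no definitions; `Y.indicator 1` is Mathlib's `Set.indicator`).  `S0_eq_of_near_const` (a 0-form constant on the cells near `x` is reproduced exactly), ★ `S0_indicator_eq_one_of_near`,
★ `S0_indicator_eq_zero_of_near`, `abs_indicator_one_le`, `abs_S0_indicator_le` (`≤ 18^d`), `abs_dgrad_indicator_le` (`≤ 1`), ★ `abs_dgrad_S0_indicator_le` (`≤ 18^d/L^k`),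
`linAvgIter_dgrad_S0_indicator` (its `k`-fold (0.4) average is the coarse coboundary `d1_Y`).
HONEST FRAMING.  Lattice bookkeeping over `…LinearLiftSmoothLin`∕`…SmoothGauge` (p592508∕p592879); count-neutral helper toward the (FL) row of 2′∕2′χ (`--supports stmt-QuantumFields-19936`);
(FL)∕`hLift` is NOT proved here; registry untouched.  YM₃ on the three-torus is RUNG R3 of the programme, not the Clay problem; no claim about d = 4, infinite volume or a mass gap.

References: T. Bałaban, Commun. Math. Phys. 109 (1987) 249–301 [Balaban1987RG1] ((0.1) p.251, (0.4) p.253).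
-/

set_option autoImplicit false

noncomputable section

namespace Summit.QuantumFields.YangMills.Theorems.LinearLiftSpread

open Finset
open Literature.MathematicalPhysics.QuantumFieldTheory.Balaban1983to89
open Literature.MathematicalPhysics.QuantumFieldTheory.Balaban1983to89.B5Eq118OneStroke (iterBlockOf)
open Summit.QuantumFields.YangMills.Theorems.AbelianEML (linAvgIter)
open Summit.QuantumFields.YangMills.Theorems.LinearLiftGauge (dgrad)
open Summit.QuantumFields.YangMills.Theorems.LinearLiftProfile

variable {P : Params} (k : ℕ) (hk : k ≤ P.m + P.K)
include hk

/-- **`S0` REPRODUCES A 0-FORM THAT IS CONSTANT ON THE CELLS NEAR `x`**: if `Φ y = Φ y₀` for every `y` near `x` then `S0 k Φ (x) = Φ y₀` (interpolation error with zero oscillation).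
[cite: Balaban1987RG1, (0.1) p.251] -/
theorem S0_eq_of_near_const (Φ : Site P k → ℝ) (x : Site P 0) (y₀ : Site P k) (hΦ : ∀ y : Site P k, Near k x y → Φ y = Φ y₀) : S0 k Φ x = Φ y₀ := by
  have h := abs_S0_sub_le_local k hk Φ x y₀ (η := 0) fun y hy => by rw [hΦ y hy, sub_self, abs_zero]
  rw [mul_zero] at h
  exact sub_eq_zero.mp (abs_nonpos_iff.mp h)

/-- **★ THE SMOOTH CUTOFF IS `1` ONE CELL INSIDE**: if every cell near `x` lies in `Y` then `S0 k 1_Y (x) = 1`. [cite: Balaban1987RG1, (0.1) p.251] -/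
theorem S0_indicator_eq_one_of_near (Y : Set (Site P k)) (x : Site P 0) (hY : ∀ y : Site P k, Near k x y → y ∈ Y) :
    S0 k (Y.indicator 1) x = 1 := by
  rw [S0_eq_of_near_const k hk (Y.indicator 1) x (iterBlockOf k x) fun y hy => ?_]
  · exact Set.indicator_of_mem (hY _ (near_self k hk x)) _
  · rw [Set.indicator_of_mem (hY y hy), Set.indicator_of_mem (hY _ (near_self k hk x))]
    rfl

/-- **★ THE SMOOTH CUTOFF IS `0` ONE CELL OUTSIDE**: if no cell near `x` lies in `Y` then `S0 k 1_Y (x) = 0`. [cite: Balaban1987RG1, (0.1) p.251] -/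
theorem S0_indicator_eq_zero_of_near (Y : Set (Site P k)) (x : Site P 0) (hY : ∀ y : Site P k, Near k x y → y ∉ Y) :
    S0 k (Y.indicator 1) x = 0 := by
  rw [S0_eq_of_near_const k hk (Y.indicator 1) x (iterBlockOf k x) fun y hy => ?_]
  · exact Set.indicator_of_notMem (hY _ (near_self k hk x)) _
  · rw [Set.indicator_of_notMem (hY y hy), Set.indicator_of_notMem (hY _ (near_self k hk x))]

omit hk in
/-- `|1_Y| ≤ 1`. [folklore] -/
theorem abs_indicator_one_le (Y : Set (Site P k)) (y : Site P k) : |Y.indicator (1 : Site P k → ℝ) y| ≤ 1 := by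
  by_cases hy : y ∈ Y
  · rw [Set.indicator_of_mem hy]; simp
  · rw [Set.indicator_of_notMem hy]; simp

/-- **THE SMOOTH CUTOFF IS BOUNDED BY `18^d`** (uniformly in `k`, `L`, the volume). [cite: Balaban1987RG1, (0.1) p.251] -/
theorem abs_S0_indicator_le (Y : Set (Site P k)) (x : Site P 0) : |S0 k (Y.indicator 1) x| ≤ (18 : ℝ) ^ P.d := by
  have h := abs_S0_le_local k hk (Y.indicator 1) x (M := 1) fun y _ => abs_indicator_one_le k Y y
  rwa [mul_one] at h

omit hk in
/-- `|d1_Y| ≤ 1` on every coarse bond. [folklore] -/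
theorem abs_dgrad_indicator_le (Y : Set (Site P k)) (c : PBond P k) : |dgrad (Y.indicator (1 : Site P k → ℝ)) c| ≤ 1 := by
  unfold dgrad
  by_cases h1 : c.tgt ∈ Y <;> by_cases h2 : c.src ∈ Y <;>
    simp [Set.indicator_of_mem, Set.indicator_of_notMem, h1, h2]

/-- **★ THE GRADIENT OF THE SMOOTH CUTOFF IS `L^{−k}`-SMALL**: `|d(S0 k 1_Y)(b)| ≤ 18^d/L^k` on every finest bond (uniformly in `k`, `Y`, the volume). [cite: Balaban1987RG1, (0.4) p.253] -/
theorem abs_dgrad_S0_indicator_le (Y : Set (Site P k)) (b : PBond P 0) : |dgrad (S0 k (Y.indicator 1)) b| ≤ (18 : ℝ) ^ P.d / (P.L : ℝ) ^ k := by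
  have h := abs_dgrad_S0_le k hk (Y.indicator 1) (M := 1) (fun c => abs_dgrad_indicator_le k Y c) b
  rwa [mul_one] at h

/-- The `k`-fold (0.4)-linear average of the cutoff gradient is the coarse coboundary of the indicator (so a cutoff gauge `exp(χ·…)` built on it is read at the centres through `1_Y` itself).
[cite: Balaban1987RG1, (0.4)+(0.11) p.253] -/
theorem linAvgIter_dgrad_S0_indicator (Y : Set (Site P k)) : linAvgIter k (dgrad (S0 k (Y.indicator 1))) = dgrad (Y.indicator 1) :=
  linAvgIter_dgrad_S0 k hk _

end Summit.QuantumFields.YangMills.Theorems.LinearLiftSpread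

end
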